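import Literature.NumberTheory.Automorphic.UnitaryGroupUnipotentHaarNormalisation   -- ★ the engine: `mul_inv_mul_integral_eq_integral_heisChart`, `integrable_comp_heisChart_prod_iff`
import Literature.NumberTheory.Automorphic.UnitaryGroupSingularTorusNormalForm       -- ★ `map_traceZeroLine_traceZeroFundamentalDomain` (`(θ_* μ_F)(𝓕⁻) = μ_F(D_F)`)
import Literature.NumberTheory.Automorphic.UnitaryGroupTraceZeroLineHaar             -- ★ `isAddHaarMeasure_map_traceZeroLine`, `integral_map_traceZeroLine`
import Literature.NumberTheory.Automorphic.TateTruncatedZetaIntegralAnyHaar          -- ★ `measure_adeleFundamentalDomain_toReal_pos`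
import Literature.NumberTheory.Automorphic.U3LocalBruhatDecompositionProofs          -- ★ `weylLongU` (the long Weyl element `w₀` of `U(J₃)(F)`)
import HarnessLib

/-!
# h413 ∕ Track B «K2-LIT», «EIS-RANK-ONE» (D2-e) brick (ν-1) — `K2E1UnipotentHaarNormalisationU3`: the `hnorm` letter of the rank-3 Eisenstein chain,
# `(ν 𝓕)⁻¹ • ∫_{N(𝔸_F)} T dν = μ_E(D_E)⁻¹ · ∫_{𝔸_E} μ_F(D_F)⁻¹ · ∫_{𝔸_F} T(u(X, θ s)) dμ_F(s) dμ_E(X)` on `U(J₃)`, for every Haar `ν` and every `ν`-integrable `T`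

Cell `pub/hodgecm-mathlib`, crux H413 = `stmt-HodgeConjecture-24833`, route `HCCMUnconditional`; dealer K2E1-plan (g4) RULING «(D2-e) SPLIT» 2026-09-04T06:25:32Z
(bricks (ν-1)(ν-2) → desk K2-defs1 (g4); the assembly (D2-e)-A `K2E1EisensteinMinusConstantTermBoundedCMThree` → K2E4-p11 (g3)).  THEOREMS ONLY (no `def`, no
`instance`, no notation, no named-fact hypothesis, no `sorry`); lane `--kind proof --supports stmt-HodgeConjecture-24833 --as helper` (count-neutral).  The N = 2 twin
is ★ `K2E1UnipotentHaarNormalisationU2` (p857675, one layer, scale-free); the companion brick (ν-2) is ★ `K2E1HeisenbergHaarU3` (`[ν.IsInvInvariant]`, `h𝓕₀`, `h𝓕top`).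

THE POINT.  ★ R6d₃ `K2E1EisensteinMinusConstantTermCuspBoundU3.forall_norm_sub_borelConstantTerm_le_three` (and ★ (a)₃ ∕ (b)₃ upstream) carries ONE bookkeeping
hypothesis `hnorm`: the big-cell integral of the constant term over the HEISENBERG radical `N(𝔸_F)` of `U(J₃)`, normalised by the mass of a fundamental domain `𝓕` of
`N(F)∖N(𝔸_F)` for the unipotent Haar measure `ν`, equals the TWO-LAYER normalised coordinate integral along the Heisenberg chart `u(X, y′) = heisChart hc (X, y′)`
with the centre read through the line `θ = traceZeroLine : 𝔸_F ≃ₜ+ 𝔸_E⁻`: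
`(ν 𝓕)⁻¹ • ∫_{N(𝔸_F)} f(w₀ v g) dν(v) = μ_E(D_E)⁻¹ · ∫_{𝔸_E} μ_F(D_F)⁻¹ · ∫_{𝔸_F} f(w₀ u(X, θ s) g) dμ_F(s) dμ_E(X)`.
Unlike the one-layer N = 2 letter this is a FUBINI statement, so it holds for `ν`-INTEGRABLE integrands (for a non-integrable one the left side is `0` by convention
while the iterated right side need not be); the integrability binder `hint` is discharged downstream from ★ [D8] `K2E1IntertwiningGrowthU3.integrable_borelHeight_weylLongU_mul_rpow`
(Godement's absolute convergence of the intertwining integral at `2 < Re z`).  Everything else is ★: Haar uniqueness `ν = r • (μ_E ⊗ μ_Y) ∘ u⁻¹` and the mass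
formula `ν(𝓕) = r · μ_E(D_E) μ_Y(𝓕⁻)` for EVERY fundamental domain (★ `UnitaryGroupUnipotentHaarNormalisation`, [Rogawski1990, §7.3 p. 97]), the transport
`μ_Y := θ_* μ_F` (★ `isAddHaarMeasure_map_traceZeroLine`, `(θ_* μ_F)(𝓕⁻) = μ_F(D_F)` ★ `map_traceZeroLine_traceZeroFundamentalDomain`), `0 < μ(D) < ∞` (Tate).

* §1 `inv_measure_smul_integral_eq_heisChart_traceZeroLine_three` — the identity for any `ν`-integrable `T : N(𝔸_F) → ℂ`; `integrable_comp_heisChart_traceZeroLine_prod_iff_three`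
  — `T` is `ν`-integrable iff `(X, s) ↦ T(u(X, θ s))` is `μ_E ⊗ μ_F`-integrable (the chart-side test).
* §2 **`inv_measure_smul_integral_weylLongU_eq_three`** ∕ **`forall_inv_measure_smul_integral_weylLongU_eq_three`** — ★ `forall_norm_sub_borelConstantTerm_le_three`'s
  hypothesis `hnorm` TOKEN FOR TOKEN (single `g` ∕ `∀ g`), under `hint : Integrable (v ↦ f(w₀ v g)) ν`.
HONEST LABEL.  Count-neutral helper; proves no printed statement; HC_CM is proved only modulo the 7 printed citations (2 remaining named inputs: hLiu418 =
`stmt-HodgeConjecture-24832`, h413 = `stmt-HodgeConjecture-24833`) until rung 0 closes.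

## References
* [Rogawski1990] J. D. Rogawski, *Automorphic Representations of Unitary Groups in Three Variables*, Ann. of Math. Stud. 123 (1990), §1.10, §7.3 (p. 97).
* [CasselsFrohlichANT1967] J. W. S. Cassels, A. Fröhlich (eds.), *Algebraic Number Theory* (1967), Ch. XV (Tate) Thm. 4.1.3.
* [MoeglinWaldspurger1995] C. Mœglin, J.-L. Waldspurger, *Spectral decomposition and Eisenstein series* (1995), I.2.6, II.1.7 (the normalisation of `dn`).
* [GetzHahn2024] J. R. Getz, H. Hahn, *An Introduction to Automorphic Representations*, GTM 300 (2024), §3.5.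
-/

set_option autoImplicit false
set_option linter.dupNamespace false  -- the mandated namespace repeats the summit's segment (`HodgeConjecture.HodgeConjecture`)

noncomputable section

open MeasureTheory Measure NumberField IsDedekindDomain
open Literature.NumberTheory.Automorphic Literature.NumberTheory.Automorphic.UnitaryGroup
open scoped ENNReal NNReal

namespace Summit.HodgeConjecture.HodgeConjecture.Cruxes.H413.K2E1UnipotentHaarNormalisationU3

variable {F E : Type} [Field F] [NumberField F] [Field E] [NumberField E] [Algebra F E] [Algebra.IsQuadraticExtension F E] {c : E ≃ₐ[F] E}
  {δ : E} (hcδ : c δ = -δ) (hδ : δ ≠ 0)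
  [MeasurableSpace (AdeleRing (𝓞 E) E)] [BorelSpace (AdeleRing (𝓞 E) E)]
  [MeasurableSpace (AdeleRing (𝓞 F) F)] [BorelSpace (AdeleRing (𝓞 F) F)]
  [MeasurableSpace ↥(adelicUnipotent F E c 3)] [BorelSpace ↥(adelicUnipotent F E c 3)]

/-! ## §1 The two-layer identity along the Heisenberg chart and the line -/

/-- **`(ν 𝓕)⁻¹ • ∫_{N(𝔸_F)} T dν = μ_E(D_E)⁻¹ · ∫_{𝔸_E} μ_F(D_F)⁻¹ · ∫_{𝔸_F} T(u(X, θ s)) dμ_F(s) dμ_E(X)`** for every Haar measure `ν` of the Heisenberg radical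
`N(𝔸_F) ≤ U(J₃)(𝔸_F)`, every `ν`-fundamental domain `𝓕` of `N(F)`, all additive Haar measures `μ_E`, `μ_F` of `𝔸_E`, `𝔸_F`, and every `ν`-INTEGRABLE `T` (★
`mul_inv_mul_integral_eq_integral_heisChart` at `μ_Y := θ_* μ_F`, ★ `map_traceZeroLine_traceZeroFundamentalDomain`, ★ `integral_map_traceZeroLine`).
[cite: Rogawski1990, §7.3 (p. 97)] [cite: CasselsFrohlichANT1967, Ch. XV Thm. 4.1.3 (2)] -/
theorem inv_measure_smul_integral_eq_heisChart_traceZeroLine_three (hc : c * c = 1)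
    (μF : Measure (AdeleRing (𝓞 F) F)) [μF.IsAddHaarMeasure] (μE : Measure (AdeleRing (𝓞 E) E)) [μE.IsAddHaarMeasure]
    (ν : Measure ↥(adelicUnipotent F E c 3)) [ν.IsHaarMeasure]
    {𝓕 : Set ↥(adelicUnipotent F E c 3)} (h𝓕 : IsFundamentalDomain ↥(rationalUnipotent F E c 3) 𝓕 ν)
    {T : ↥(adelicUnipotent F E c 3) → ℂ} (hT : Integrable T ν) :
    ((ν 𝓕).toReal⁻¹ : ℝ) • ∫ v, T v ∂ν =
      ((μE (adeleFundamentalDomain E)).toReal⁻¹ : ℂ) * ∫ X, ((μF (adeleFundamentalDomain F)).toReal⁻¹ : ℂ) * ∫ s, T (heisChart hc (X, traceZeroLine F E c hcδ hδ s)) ∂μF ∂μE := by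
  haveI := locallyCompactSpace_adeleRing' E
  letI : MeasurableSpace ↥(unipotentInBorel F E c 3) := borel _
  haveI : BorelSpace ↥(unipotentInBorel F E c 3) := ⟨rfl⟩
  haveI := isAddHaarMeasure_map_traceZeroLine E c hcδ hδ μF
  have key := mul_inv_mul_integral_eq_integral_heisChart hc μE (μF.map (traceZeroLine F E c hcδ hδ)) ν h𝓕 hT
  rw [map_traceZeroLine_traceZeroFundamentalDomain E c hcδ hδ hc μF, ENNReal.toReal_mul, Complex.ofReal_mul] at key
  have hin : ∀ X : AdeleRing (𝓞 E) E, ∫ y', T (heisChart hc (X, y')) ∂(μF.map (traceZeroLine F E c hcδ hδ)) = ∫ s, T (heisChart hc (X, traceZeroLine F E c hcδ hδ s)) ∂μF :=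
    fun X => integral_map_traceZeroLine E c hcδ hδ μF _
  simp_rw [hin] at key
  have ha : ((μE (adeleFundamentalDomain E)).toReal : ℂ) ≠ 0 := by exact_mod_cast (measure_adeleFundamentalDomain_toReal_pos μE).ne'
  have hb : ((μF (adeleFundamentalDomain F)).toReal : ℂ) ≠ 0 := by exact_mod_cast (measure_adeleFundamentalDomain_toReal_pos μF).ne'
  rw [Complex.real_smul, Complex.ofReal_inv, integral_const_mul]
  calc ((ν 𝓕).toReal : ℂ)⁻¹ * ∫ v, T v ∂ν
      = (((μE (adeleFundamentalDomain E)).toReal : ℂ) * ((μF (adeleFundamentalDomain F)).toReal : ℂ))⁻¹ *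
          ((((μE (adeleFundamentalDomain E)).toReal : ℂ) * ((μF (adeleFundamentalDomain F)).toReal : ℂ)) * ((ν 𝓕).toReal : ℂ)⁻¹ * ∫ v, T v ∂ν) := by
        rw [mul_assoc, ← mul_assoc _⁻¹, inv_mul_cancel₀ (mul_ne_zero ha hb), one_mul]
    _ = ((μE (adeleFundamentalDomain E)).toReal⁻¹ : ℂ) * (((μF (adeleFundamentalDomain F)).toReal⁻¹ : ℂ) * ∫ X, ∫ s, T (heisChart hc (X, traceZeroLine F E c hcδ hδ s)) ∂μF ∂μE) := by
        rw [key, mul_inv, mul_assoc]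

/-- **The chart-side integrability test**: `T` is `ν`-integrable iff `(X, s) ↦ T(u(X, θ s))` is `μ_E ⊗ μ_F`-integrable (★ `integrable_comp_heisChart_prod_iff` at
`μ_Y := θ_* μ_F`, Mathlib `Measure.map_prod_map`, `θ` a measurable equivalence). [cite: Rogawski1990, §7.3 (p. 97)] -/
theorem integrable_comp_heisChart_traceZeroLine_prod_iff_three (hc : c * c = 1)
    (μF : Measure (AdeleRing (𝓞 F) F)) [μF.IsAddHaarMeasure] (μE : Measure (AdeleRing (𝓞 E) E)) [μE.IsAddHaarMeasure]
    (ν : Measure ↥(adelicUnipotent F E c 3)) [ν.IsHaarMeasure] (T : ↥(adelicUnipotent F E c 3) → ℂ) :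
    Integrable (fun p : AdeleRing (𝓞 E) E × AdeleRing (𝓞 F) F => T (heisChart hc (p.1, traceZeroLine F E c hcδ hδ p.2))) (μE.prod μF) ↔ Integrable T ν := by
  haveI := locallyCompactSpace_adeleRing' E
  haveI := locallyCompactSpace_adeleRing' F
  haveI := secondCountableTopology_adeleRing E
  haveI := secondCountableTopology_adeleRing F
  letI : MeasurableSpace ↥(unipotentInBorel F E c 3) := borel _
  haveI : BorelSpace ↥(unipotentInBorel F E c 3) := ⟨rfl⟩
  haveI := isAddHaarMeasure_map_traceZeroLine E c hcδ hδ μF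
  rw [← integrable_comp_heisChart_prod_iff hc μE (μF.map (traceZeroLine F E c hcδ hδ)) ν T]
  have hprod : μE.prod (μF.map (traceZeroLine F E c hcδ hδ)) =
      (μE.prod μF).map (Prod.map id (traceZeroLine F E c hcδ hδ)) := by
    rw [← Measure.map_prod_map μE μF measurable_id (measurable_traceZeroLine E c hcδ hδ), Measure.map_id]
  have hme : MeasurableEmbedding (Prod.map (id : AdeleRing (𝓞 E) E → AdeleRing (𝓞 E) E) (traceZeroLine F E c hcδ hδ)) :=
    MeasurableEmbedding.id.prodMap (traceZeroLine F E c hcδ hδ).toHomeomorph.toMeasurableEquiv.measurableEmbedding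
  rw [hprod, hme.integrable_map_iff]
  rfl

/-! ## §2 The `hnorm` letter of the R6d₃ chain -/

/-- **THE `hnorm` LETTER AT ONE `g`** (★ R6d₃ (a)₃ `K2E1EisensteinMinusConstantTermPoissonU3`, ★ (b)₃ `…BoundU3`): for every `f : U(J₃)(𝔸_F) → ℂ` and every `g` with
`v ↦ f(ι(w₀) · v · g)` `ν`-integrable,
`(ν 𝓕)⁻¹ • ∫_{N(𝔸_F)} f(ι(w₀) · v · g) dν(v) = μ_E(D_E)⁻¹ · ∫_{𝔸_E} μ_F(D_F)⁻¹ · ∫_{𝔸_F} f(ι(w₀) · u(X, θ s) · g) dμ_F(s) dμ_E(X)`.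
[cite: MoeglinWaldspurger1995, II.1.7] [cite: Rogawski1990, §7.3 (p. 97)] -/
theorem inv_measure_smul_integral_weylLongU_eq_three (hc : c * c = 1)
    (μF : Measure (AdeleRing (𝓞 F) F)) [μF.IsAddHaarMeasure] (μE : Measure (AdeleRing (𝓞 E) E)) [μE.IsAddHaarMeasure]
    (νN : Measure ↥(adelicUnipotent F E c 3)) [νN.IsHaarMeasure]
    {𝓕 : Set ↥(adelicUnipotent F E c 3)} (h𝓕 : IsFundamentalDomain ↥(rationalUnipotent F E c 3) 𝓕 νN)
    (f : (quasiSplit F E c 3).Adelic → ℂ) (g : (quasiSplit F E c 3).Adelic)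
    (hint : Integrable (fun v : ↥(adelicUnipotent F E c 3) =>
      f (((quasiSplit F E c 3).toAdelic (weylLongU (c : E →+* E) (rfl : ((StdForm.antidiagonal 3).over E) = ((StdForm.antidiagonal 3).over E)))) * (v : (quasiSplit F E c 3).Adelic) * g)) νN) :
    ((νN 𝓕).toReal⁻¹ : ℝ) • ∫ v : ↥(adelicUnipotent F E c 3), f (((quasiSplit F E c 3).toAdelic (weylLongU (c : E →+* E) (rfl : ((StdForm.antidiagonal 3).over E) = ((StdForm.antidiagonal 3).over E)))) * (v : (quasiSplit F E c 3).Adelic) * g) ∂νN =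
      ((μE (adeleFundamentalDomain E)).toReal⁻¹ : ℂ) * ∫ X, ((μF (adeleFundamentalDomain F)).toReal⁻¹ : ℂ) * ∫ s, f (((quasiSplit F E c 3).toAdelic (weylLongU (c : E →+* E) (rfl : ((StdForm.antidiagonal 3).over E) = ((StdForm.antidiagonal 3).over E)))) * ((heisChart hc (X, traceZeroLine F E c hcδ hδ s) : ↥(adelicUnipotent F E c 3)) : (quasiSplit F E c 3).Adelic) * g) ∂μF ∂μE :=
  inv_measure_smul_integral_eq_heisChart_traceZeroLine_three hcδ hδ hc μF μE νN h𝓕 hint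

/-- **THE `hnorm` LETTER, `∀ g` FORM** — ★ `K2E1EisensteinMinusConstantTermCuspBoundU3.forall_norm_sub_borelConstantTerm_le_three`'s hypothesis `hnorm` token for token, for every
Haar measure `νN` of `N(𝔸_F)`, every `νN`-fundamental domain `𝓕` of `N(F)`, all additive Haar measures `μ_F`, `μ_E`, every `f` whose big-cell translates are `νN`-integrable
(`hint`, ★ [D8] `integrable_borelHeight_weylLongU_mul_rpow` for the flat section). [cite: MoeglinWaldspurger1995, II.1.7] [cite: Rogawski1990, §7.3 (p. 97)] -/
theorem forall_inv_measure_smul_integral_weylLongU_eq_three (hc : c * c = 1)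
    (μF : Measure (AdeleRing (𝓞 F) F)) [μF.IsAddHaarMeasure] (μE : Measure (AdeleRing (𝓞 E) E)) [μE.IsAddHaarMeasure]
    (νN : Measure ↥(adelicUnipotent F E c 3)) [νN.IsHaarMeasure]
    {𝓕 : Set ↥(adelicUnipotent F E c 3)} (h𝓕 : IsFundamentalDomain ↥(rationalUnipotent F E c 3) 𝓕 νN)
    (f : (quasiSplit F E c 3).Adelic → ℂ)
    (hint : ∀ g : (quasiSplit F E c 3).Adelic, Integrable (fun v : ↥(adelicUnipotent F E c 3) =>
      f (((quasiSplit F E c 3).toAdelic (weylLongU (c : E →+* E) (rfl : ((StdForm.antidiagonal 3).over E) = ((StdForm.antidiagonal 3).over E)))) * (v : (quasiSplit F E c 3).Adelic) * g)) νN) :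
    ∀ g : (quasiSplit F E c 3).Adelic, ((νN 𝓕).toReal⁻¹ : ℝ) • ∫ v : ↥(adelicUnipotent F E c 3), f (((quasiSplit F E c 3).toAdelic (weylLongU (c : E →+* E) (rfl : ((StdForm.antidiagonal 3).over E) = ((StdForm.antidiagonal 3).over E)))) * (v : (quasiSplit F E c 3).Adelic) * g) ∂νN =
      ((μE (adeleFundamentalDomain E)).toReal⁻¹ : ℂ) * ∫ X, ((μF (adeleFundamentalDomain F)).toReal⁻¹ : ℂ) * ∫ s, f (((quasiSplit F E c 3).toAdelic (weylLongU (c : E →+* E) (rfl : ((StdForm.antidiagonal 3).over E) = ((StdForm.antidiagonal 3).over E)))) * ((heisChart hc (X, traceZeroLine F E c hcδ hδ s) : ↥(adelicUnipotent F E c 3)) : (quasiSplit F E c 3).Adelic) * g) ∂μF ∂μE :=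
  fun g => inv_measure_smul_integral_weylLongU_eq_three hcδ hδ hc μF μE νN h𝓕 f g (hint g)

end Summit.HodgeConjecture.HodgeConjecture.Cruxes.H413.K2E1UnipotentHaarNormalisationU3

end
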